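import Literature.NumberTheory.LFunctions.DeBruijnNewmanUpperBound
import HarnessLib

/-!
# The rectangles behind Polymath 15, Table 1, row 2

Companion of `DeBruijnNewmanUpperBound.lean` (named fact
`Literature.NumberTheory.LFunctions.Polymath15.table1_row2`).

The computer verification of `table1_row2` (Polymath 15, Res. Math. Sci. 6 (2019) 31, §8.4–8.5, run for
the §10 Table 1 row-2 parameters `t₀ = 0.186`, `y₀ = 0.16733`, `X = 5·10¹² + 194858`, `N₀ = 630783`)
establishes non-vanishing of `H_t` on two *rectangular* regions that contain the curved regions of
Thm. 1.2 (ii), (iii):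

* for (ii): `H_{t₀}(x + iy) ≠ 0` for all `x ≥ X`, `y₀ ≤ y ≤ 1` (the region of claims (b), (c) of §8.2:
  an argument principle for `E·H_{t₀}/B_{t₀}` on `{x ≥ X, y₀ ≤ y ≤ 1, N ≤ N₁}` plus the crude bound for
  `N ≥ N₁`);
* for (iii): `H_t(x + iy) ≠ 0` for `0 ≤ t ≤ t₀`, `X ≤ x ≤ X + 1`, `y₀ ≤ y ≤ 1` (the rectangle `R` of
  §8.4, "we have enlarged the region (iii) for simplicity": winding number `0` of `f_t` around `∂R` at
  every mesh time).

The elementary containment of the Thm. 1.2 regions in these rectangles is the last step of that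
verification; it is proved here so that a certificate for `table1_row2` only has to deliver the two
rectangle statements (`Polymath15.table1_row2_of_rectangles`). Nothing here is specific to the numerical
method; the analytic input of the verification (Polymath 15, Thm. 1.3, the effective approximation
`H_t/B_t = f_t + O(e_A + e_B + e_{C,0})`) is not formalised in the tree.

## References

* D. H. J. Polymath, *Effective approximation of heat flow evolution of the Riemann `ξ` function, and a
  new upper bound for the de Bruijn–Newman constant*, Res. Math. Sci. 6 (2019) 31 (arXiv:1904.12438),
  §8.2 (regions (ii), (iii); claims (a), (b), (c)), §8.4, §8.5, §10 Table 1.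
-/

noncomputable section

open Complex

namespace Literature.NumberTheory.LFunctions

namespace Polymath15

/-- Rectangle form of hypotheses (ii) and (iii) of Polymath 15, Thm. 1.2, for general parameters: if
`H_{t₀}` has no zeros with `x ≥ X`, `y₀ ≤ y ≤ 1`, and `H_t` (`0 ≤ t ≤ t₀`) has none with
`X ≤ x ≤ X + 1`, `y₀ ≤ y ≤ 1`, then `FinalZeroFree t₀ X y₀` and `BarrierZeroFree t₀ X y₀` hold, provided
`0 ≤ t₀` and `0 ≤ y₀` (because `√(1 − y₀²) ≤ 1`, `√(1 − 2t) ≤ 1` and `y₀ ≤ √(y₀² + 2(t₀ − t))`). This is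
the reduction "it will suffice to verify that `H_t(x+iy) ≠ 0` for the following regions ... Here we have
enlarged the region (iii) for simplicity" of §8.2.
[cite: Polymath2019, §8.2 (regions (ii), (iii) and claims (a), (b), (c))] -/
theorem final_and_barrier_of_rectangles {t₀ X y₀ : ℝ} (ht₀ : 0 ≤ t₀) (hy₀ : 0 ≤ y₀)
    (hii : ∀ x y : ℝ, X ≤ x → y₀ ≤ y → y ≤ 1 → deBruijnH t₀ (x + y * I) ≠ 0)
    (hiii : ∀ t x y : ℝ, 0 ≤ t → t ≤ t₀ → X ≤ x → x ≤ X + 1 → y₀ ≤ y → y ≤ 1 →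
      deBruijnH t (x + y * I) ≠ 0) :
    FinalZeroFree t₀ X y₀ ∧ BarrierZeroFree t₀ X y₀ := by
  have hsq1 : ∀ u : ℝ, u ≤ 1 → Real.sqrt u ≤ 1 := fun u hu ↦ by
    simpa using Real.sqrt_le_sqrt hu
  refine ⟨?_, ?_⟩
  · intro x y hx hy hy'
    refine hii x y ?_ hy (hy'.trans (hsq1 (1 - 2 * t₀) (by linarith)))
    exact le_trans (le_add_of_nonneg_right (Real.sqrt_nonneg _)) hx
  · intro t x y ht ht' hX hx hylo hyhi
    refine hiii t x y ht ht' hX (hx.trans ?_) (le_trans ?_ hylo)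
      (hyhi.trans (hsq1 (1 - 2 * t) (by linarith)))
    · linarith [hsq1 (1 - y₀ ^ 2) (by nlinarith)]
    · calc y₀ = Real.sqrt (y₀ ^ 2) := (Real.sqrt_sq hy₀).symm
        _ ≤ Real.sqrt (y₀ ^ 2 + 2 * (t₀ - t)) := Real.sqrt_le_sqrt (by nlinarith)

/-- **Table 1, row 2 from its two rectangles.** If `H_{0.186}(x + iy) ≠ 0` for all
`x ≥ 5·10¹² + 194858`, `0.16733 ≤ y ≤ 1`, and `H_t(x + iy) ≠ 0` for all `0 ≤ t ≤ 0.186`,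
`5·10¹² + 194858 ≤ x ≤ 5·10¹² + 194859`, `0.16733 ≤ y ≤ 1`, then `table1_row2` holds. These two
rectangle statements are what the computation behind the table row (Polymath 15, §8, claims (a),
(b), (c) with the row-2 parameters, `N₀ = 630783`), and any independent re-verification of it,
establishes conditionally on the effective approximation theorem (Polymath 15, Thm. 1.3 / Cor. 1.4).
[cite: Polymath2019, §10, Table 1 (row 2)] -/
theorem table1_row2_of_rectangles
    (hii : ∀ x y : ℝ, (5 * 10 ^ 12 + 194858 : ℝ) ≤ x → (0.16733 : ℝ) ≤ y → y ≤ 1 →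
      deBruijnH 0.186 (x + y * I) ≠ 0)
    (hiii : ∀ t x y : ℝ, 0 ≤ t → t ≤ 0.186 → (5 * 10 ^ 12 + 194858 : ℝ) ≤ x →
      x ≤ 5 * 10 ^ 12 + 194858 + 1 → (0.16733 : ℝ) ≤ y → y ≤ 1 → deBruijnH t (x + y * I) ≠ 0) :
    table1_row2 :=
  final_and_barrier_of_rectangles (by norm_num) (by norm_num) hii hiii

end Polymath15

end Literature.NumberTheory.LFunctions

end
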